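import Summits.BirchSwinnertonDyer.Rank1Residual.Additive.TwistedBranchPAdicGrossZagier
import Summits.BirchSwinnertonDyer.Rank1Residual.Additive.TameBranchGrossZagier
import Summits.BirchSwinnertonDyer.Rank1Residual.Additive.TameBranchOfTwistBranchOdd
import Summits.BirchSwinnertonDyer.Rank1Residual.Additive.LegendreTwistMinusRelationOfCurveTwist
import Summits.BirchSwinnertonDyer.Rank1Residual.Additive.TameBranchKatoDivisibilityOfDelbourgo
import Summits.BirchSwinnertonDyer.Rank1Residual.Additive.GordRankZeroChiBranch
import Summits.BirchSwinnertonDyer.Rank1Residual.GaloisImage.KatoKuriharaValueOfComparison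
import Literature.NumberTheory.EllipticCurves.Pal2012.QuadraticTwistPeriodProofs
import HarnessLib

/-!
# Row B6 (O7-ord), defect 2, E-NORMALISED CURRENCY, ODD branch (`p ≡ 3 (mod 4)`): the constant of the
# Legendre MINUS relation is `±ϖ'_V/(n_E·ϖ_E)` (Pal 2012, `d < 0`), hence the typed tame-branch
# `p`-adic Gross–Zagier formula `TameBranchPAdicGrossZagierAt W p Dh` follows from the twisted-branch
# clauses on the (G-ord, `e = 2`) rows at `p ≡ 3 (mod 4)` too
# (cell `bsd-addord`, seat `bsd-addord-gz`, session 3; odd twin of `TameBranchGrossZagierOfTwisted.lean`)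

HONEST FRAMING. Theorems only: no definition, no named fact, no `sorry`, nothing booked, labels
UNCHANGED. At `p ≡ 3 (mod 4)` the semistable twist is `V = E ⊗ χ_{−p}`, the E-normalised tame branch is
`C(c)·L⁻_p(f_V, α_V, ω^{(p−1)/2}, T)` for the constant `c` of the MINUS relation
`LegendreTwistMinusRel p f_E f_V c` (`[s]⁺_{f_E} = c·∑_u (u/p)[s+u/p]⁻_{f_V}`;
`TameBranchOfTwistBranchOdd.lean`), which the tree leaves unnormalised. §1: **`c = ±ϖ'/(n_E·ϖ)`**,
where `ϖ·Ω_E = Ω⁺_{f_E}`, `ϖ'·|Ω⁻_V| = Ω⁻_{f_V}` and `n_E ∈ {1,2}` is the number of real components of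
`E` — from `Ω⁺_{f_E}[s]⁺_{f_E} = τ(χ_p)⁻¹·Ω⁻_{f_V}·i·(∑…)` (`plusSymbol_eq_sum_minusSymbol_of_cuspCoeff_eq`),
`τ(χ_p)² = −p` (Mathlib `gaussSum_sq`, `χ_p(−1) = −1`) and Pal 2012 Thm. 3.2 (`d < 0`):
`Ω_E·√p = n_E·|Ω⁻_V|` (tree theorem `Pal2012.realPeriodRat_mul_sqrt_eq_of_twist_neg_prime`), the only
ambiguity being `√p·i/τ(χ_p) ∈ {±1}`. §2: by tuple rigidity the twisted-branch clauses
`TwistedBranchGrossZagierAt W p Dh` (bare `Prop` of the Literature fact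
`Disegni2017.delbourgoDatum_rankOne_leadingTerms`, REF-gz PASS with condition GZ-H) give the
E-normalised typed input `TameBranchPAdicGrossZagierAt W p Dh` on (G-ord, `e = 2`) ∩ `p ≡ 3 (mod 4)`
(`p ≥ 7`) in analytic rank one (the unit absorbs `±1/n_E`, a `p`-adic unit as `p` is odd). §3: the
E-currency datum from the defect-2 fact and the L3.N1″ HEADLINE supplied on these rows. REFEREE
CONDITION GZ-H (binding locator for the fact, verbatim in substance): the height identification behind
the fact's Gross–Zagier half is Disegni 2017 Rem. 1.3.2's (n-exc)-conditional printed sentence + Disegni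
2022 Thm. B context, (n-exc) discharged by `ε_p` ramified; not Delbourgo 2002 p. 62; Nekovář 1993 §7.14
unheld (acq-10827). (These rows have `V` GOOD ordinary.)

## What is NOT claimed

Nothing on (M), at defect `3,4,6`, at `p = 3` (the fact's (G) hypothesis needs `p ≥ 5`); no booking.

References: [Pal2012] Thm. 3.2 (d < 0), Prop. 2.5, p. 1514; [MazurTateTeitelbaum1986Invent] §I.8,
§I.13–I.14; [Shimura1971] Prop. 3.64; [Delbourgo2002] Thm. (A), (B), (C) p. 40; [Disegni2017] Thm. B,
Rem. 1.3.2; [Miller2011LMS] Def. 1.1; cell memos PROOF-gz.md §3, PROOF-gz2.md Remark 0.3.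
-/

noncomputable section

open scoped Classical MatrixGroups ModularForm NumberField

open CongruenceSubgroup WeierstrassCurve NumberField IsDedekindDomain
  Literature.NumberTheory.EllipticCurves Literature.NumberTheory.EllipticCurves.ModularForms
  Literature.NumberTheory.EllipticCurves.Rank1Residual
  Literature.NumberTheory.EllipticCurves.Rank1Residual.Typed
  Literature.NumberTheory.EllipticCurves.Delbourgo2002
  Literature.NumberTheory.EllipticCurves.Disegni2017

namespace Summit.BirchSwinnertonDyer.Rank1Residual.Additive

variable {p : ℕ} [hp : Fact p.Prime]

/-! ### §1 The Legendre MINUS relation with its constant NORMALISED: `c = ±ϖ'/(n_E·ϖ)` -/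

/-- `τ(χ_p)² = −p` for the quadratic character mod `p ≡ 3 (mod 4)` with values in `ℂ` (Mathlib's
`gaussSum_sq` with `χ_p(−1) = χ₄(p) = −1`). [folklore] -/
theorem gaussSum_quadraticChar_sq_eq_neg_of_mod_four_eq_three (hp4 : p % 4 = 3) :
    gaussSum ((quadraticChar (ZMod p)).ringHomComp (Int.castRingHom ℂ)) (ZMod.stdAddChar (N := p)) ^ 2
      = -(p : ℂ) := by
  have hp2 : p ≠ 2 := by omega
  haveI : NeZero p := ⟨hp.out.ne_zero⟩
  have hchar : ringChar (ZMod p) ≠ 2 := by rw [ZMod.ringChar_zmod_n]; exact hp2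
  have hne : (quadraticChar (ZMod p)).ringHomComp (Int.castRingHom ℂ) ≠ 1 :=
    (MulChar.ringHomComp_ne_one_iff Int.cast_injective).mpr (quadraticChar_ne_one hchar)
  have hquad : ((quadraticChar (ZMod p)).ringHomComp (Int.castRingHom ℂ)).IsQuadratic :=
    (quadraticChar_isQuadratic (ZMod p)).comp _
  rw [gaussSum_sq hne hquad (ZMod.isPrimitive_stdAddChar p), MulChar.ringHomComp_apply,
    quadraticChar_neg_one hchar, ZMod.card, ZMod.χ₄_nat_three_mod_four hp4]
  simp

/-- The number of real components is `1` or `2`. [folklore] -/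
theorem numRealComponents_eq_one_or_two (W : WeierstrassCurve ℝ) :
    W.numRealComponents = 1 ∨ W.numRealComponents = 2 := by
  unfold WeierstrassCurve.numRealComponents
  split_ifs <;> simp

/-- **The Legendre MINUS relation NORMALISED (odd branch).** For `E = W ≅ V ⊗ χ_{−p}` additive at
`p ≡ 3 (mod 4)`, `V` globally minimal and semistable at `p`, `f`, `g` the newforms of `W`, `V`, period
indices `ϖ·Ω_E = Ω⁺_f`, `ϖ'·|Ω⁻_V| = Ω⁻_g`, and `n = #components of E(ℝ)`: the relation
`[s]⁺_f = c·∑_{u mod p}(u/p)[s+u/p]⁻_g` holds with **`c = ϖ'/(n·ϖ)` or `c = −ϖ'/(n·ϖ)`**.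
[cite: Pal2012, Thm. 3.2 (case d < 0) with Prop. 2.5, and p. 1514 (Ω⁻)]
[cite: MazurTateTeitelbaum1986Invent, §I.8] [cite: Shimura1971, Prop. 3.64] -/
theorem exists_legendreTwistMinusRel_eq_periodIndex (hp4 : p % 4 = 3)
    (V W : WeierstrassCurve ℚ) [V.IsElliptic] [V.IsGloballyMinimal] [W.IsElliptic]
    [W.IsGloballyMinimal] (hVW : ∃ C : VariableChange ℚ, C • V.quadraticTwist (-(p : ℚ)) = W)
    (hadd : Addv W p) (hV : V.HasGoodReductionAtPrime p ∨ V.HasMultiplicativeReductionAtPrime p)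
    {N N' : ℕ} [NeZero N] [NeZero N'] {f : CuspForm (Gamma0 N) 2} {g : CuspForm (Gamma0 N') 2}
    (hf : IsNewformOf W f) (hg : IsNewformOf V g) (ϖ ϖ' : ℚ)
    (hϖ : (ϖ : ℝ) * W.realPeriodRat = plusPeriod f)
    (hϖ' : (ϖ' : ℝ) * V.imaginaryPeriodRat = minusPeriod g) :
    ∃ c : ℚ, LegendreTwistMinusRel p f g c ∧
      (c = ϖ' / ((W.baseChange ℝ).numRealComponents * ϖ) ∨
        c = -(ϖ' / ((W.baseChange ℝ).numRealComponents * ϖ))) := by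
  obtain ⟨hp2, hodd⟩ := ne_two_and_legendreSym_neg_one_of_mod_four_eq_three (p := p) hp4
  haveI : NeZero p := ⟨hp.out.ne_zero⟩
  have h := cuspCoeff_eq_legendreSym_mul_cuspCoeff_of_twist_neg hp4 V W hVW hadd hf hg
  have hrealf : ∀ n, (cuspCoeff f n).im = 0 := cuspCoeff_im_eq_zero_of_coeffField_eq_bot hf.coeffField_eq_bot
  have hΩf : 0 < plusPeriod f := IsNewform0.plusPeriod_pos_holds hf.1 hf.coeffField_eq_bot
  have hPf : ∀ r : ℚ, plusSymbol f r = ((plusPeriod f * (ratPlusSymbol f r : ℝ) : ℝ) : ℂ) := by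
    intro r
    have h1 := plusSymbol_eq_re_holds f hrealf r
    have h2 : (ratPlusSymbol f r : ℝ) = (plusSymbol f r).re / plusPeriod f :=
      ratCast_ratPlusSymbol_holds hf.1 hf.coeffField_eq_bot r
    have h3 : (plusSymbol f r).re = plusPeriod f * (ratPlusSymbol f r : ℝ) := by
      rw [h2]; field_simp
    rw [← h3, h1, Complex.ofReal_re]
  have hMg : ∀ r : ℚ, minusSymbol g r =
      ((ratMinusSymbol g r : ℚ) : ℂ) * ((minusPeriod g : ℝ) : ℂ) * Complex.I := fun r ↦
    (ratMinusSymbol_mul_minusPeriod_mul_I g hg.1 hg.coeffField_eq_bot r).symm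
  -- the Gauss sum `τ` and the twisted sums `q₂`
  set τ : ℂ := gaussSum ((quadraticChar (ZMod p)).ringHomComp (Int.castRingHom ℂ))
    (ZMod.stdAddChar (N := p)) with hτ
  have hτsq : τ ^ 2 = -(p : ℂ) := gaussSum_quadraticChar_sq_eq_neg_of_mod_four_eq_three hp4
  have hpC : (p : ℂ) ≠ 0 := by exact_mod_cast hp.out.ne_zero
  have hτ0 : τ ≠ 0 := by
    intro h0; rw [h0, zero_pow two_ne_zero] at hτsq; exact hpC (neg_eq_zero.mp hτsq.symm)
  set q₂ : ℚ → ℚ := fun s ↦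
    ∑ u : ZMod p, (legendreSym p (u.val : ℤ) : ℚ) * ratMinusSymbol g (s + (u.val : ℚ) / p) with hq₂
  have hC : ∀ s : ℚ, ((plusPeriod f : ℝ) : ℂ) * ((ratPlusSymbol f s : ℚ) : ℂ) =
      τ⁻¹ * ((minusPeriod g : ℝ) : ℂ) * Complex.I * ((q₂ s : ℚ) : ℂ) := by
    intro s
    have hs := plusSymbol_eq_sum_minusSymbol_of_cuspCoeff_eq hp2 hodd h s
    rw [hPf] at hs
    simp_rw [hMg] at hs
    rw [hq₂]
    push_cast at hs ⊢
    rw [hs, Finset.mul_sum, Finset.mul_sum]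
    refine Finset.sum_congr rfl fun u _ ↦ ?_
    ring
  -- the periods: `Ω⁺_f = ϖ Ω_E`, `Ω⁻_g = ϖ' |Ω⁻_V|`, `Ω_E √p = n |Ω⁻_V|` (Pal, `d < 0`)
  have hPal : W.realPeriodRat * Real.sqrt p = (W.baseChange ℝ).numRealComponents * V.imaginaryPeriodRat :=
    Pal2012.realPeriodRat_mul_sqrt_eq_of_twist_neg_prime V W p hp4 hV hVW
  set n : ℕ := (W.baseChange ℝ).numRealComponents with hn
  have hn0 : (n : ℂ) ≠ 0 := by exact_mod_cast (W.baseChange ℝ).numRealComponents_pos.ne'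
  have hΩE : (W.realPeriodRat : ℂ) ≠ 0 := by exact_mod_cast W.realPeriodRat_pos_holds.ne'
  have hϖ0 : ϖ ≠ 0 := X2.varpi_ne_zero_of_isNewformOf hf hϖ
  have hϖC : (ϖ : ℂ) ≠ 0 := by exact_mod_cast hϖ0
  have hsqrt : ((Real.sqrt p : ℝ) : ℂ) ^ 2 = (p : ℂ) := by
    rw [← Complex.ofReal_pow, Real.sq_sqrt (Nat.cast_nonneg p)]; push_cast; rfl
  have hsqrt0 : ((Real.sqrt p : ℝ) : ℂ) ≠ 0 := by
    intro h0; rw [h0, zero_pow two_ne_zero] at hsqrt; exact hpC hsqrt.symm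
  -- `λ = √p · i / τ` has `λ² = 1`
  set lam : ℂ := ((Real.sqrt p : ℝ) : ℂ) * Complex.I * τ⁻¹ with hlam
  have hlam2 : lam * lam = 1 := by
    rw [hlam, ← pow_two, mul_pow, mul_pow, inv_pow, hsqrt, hτsq, Complex.I_sq]
    field_simp
  have hlam1 : lam = 1 ∨ lam = -1 := mul_self_eq_one_iff.mp hlam2
  -- `[s]_f = λ (ϖ'/(n ϖ)) q₂ s`
  have hkey : ∀ s : ℚ, ((ratPlusSymbol f s : ℚ) : ℂ) =
      lam * ((ϖ' / (n * ϖ) : ℚ) : ℂ) * ((q₂ s : ℚ) : ℂ) := by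
    intro s
    have hs := hC s
    have hf' : ((plusPeriod f : ℝ) : ℂ) = (ϖ : ℂ) * (W.realPeriodRat : ℂ) := by
      rw [← hϖ]; push_cast; ring
    -- `n · Ω⁻_g = ϖ' · Ω_E · √p`
    have hPalC : (W.realPeriodRat : ℂ) * ((Real.sqrt p : ℝ) : ℂ) =
        (n : ℂ) * (V.imaginaryPeriodRat : ℂ) := by
      have hh := congrArg (fun x : ℝ ↦ (x : ℂ)) hPal
      push_cast at hh
      exact hh
    have hg' : (n : ℂ) * ((minusPeriod g : ℝ) : ℂ) =
        (ϖ' : ℂ) * ((W.realPeriodRat : ℂ) * ((Real.sqrt p : ℝ) : ℂ)) := by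
      rw [← hϖ', hPalC]; push_cast; ring
    have hs' : (n : ℂ) * (((plusPeriod f : ℝ) : ℂ) * ((ratPlusSymbol f s : ℚ) : ℂ)) =
        τ⁻¹ * ((n : ℂ) * ((minusPeriod g : ℝ) : ℂ)) * Complex.I * ((q₂ s : ℚ) : ℂ) := by
      rw [hs]; ring
    rw [hf', hg'] at hs'
    rw [hlam]
    push_cast
    field_simp
    field_simp at hs'
    linear_combination hs'
  rcases hlam1 with h1 | h1
  · refine ⟨ϖ' / (n * ϖ), fun s ↦ ?_, Or.inl rfl⟩
    apply Rat.cast_injective (α := ℂ)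
    have := hkey s
    rw [h1, one_mul] at this
    rw [this, hq₂]
    push_cast
    ring
  · refine ⟨-(ϖ' / (n * ϖ)), fun s ↦ ?_, Or.inr rfl⟩
    apply Rat.cast_injective (α := ℂ)
    have := hkey s
    rw [h1] at this
    rw [this, hq₂]
    push_cast
    ring

/-! ### §2 Defect 2, `p ≡ 3 (mod 4)`, (G-ord): the twisted-branch clauses give the E-normalised input -/

variable {W : WeierstrassCurve ℚ} [W.IsElliptic] [W.IsGloballyMinimal]

/-- **E-currency from V-currency at defect 2 (ODD branch).** For `E = W` additive at `p ≡ 3 (mod 4)`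
with a GOOD ORDINARY twist model `C • V^{(−p)} = W`, `r_an(E) = 1`, and a datum `Dh` carrying
`TwistedBranchGrossZagierAt W p Dh`: **`TameBranchPAdicGrossZagierAt W p Dh` holds** (every tuple of the
E-normalised package). Proof: dictionary `isTameBranchOf_legendre_C_mul_padicLFunctionMinusBranch` +
rigidity `IsTameBranchOf.eq_zero_or_tuple_eq` + §1 (`c = ±ϖ'/(n·ϖ)`): `ϖ·[T¹]B = ±n⁻¹·ϖ'·[T¹]L⁻_p`,
and the V-clause `ϖ'[T¹]L⁻_p·log_p γ = u·q·Reg_p(E,Dh)` becomes the E-clause with the unit `±u/n`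
(`n ∈ {1,2}`, `p` odd). [cite: Pal2012, Thm. 3.2 (case d < 0)] [cite: MazurTateTeitelbaum1986Invent, §I.13–I.14]
[cite: Disegni2017, Thm. B (§1.3.2) (provenance of the clause `hTw`; nothing asserted)] -/
theorem tameBranchPAdicGrossZagierAt_of_twisted_of_goodOrd_twist_odd (hp4 : p % 4 = 3)
    (hmodD : nonempty_modularParametrizationData)
    (hGZK : rank_eq_analyticRank_of_analyticRank_le_one) (hadd : Addv W p)
    (V : WeierstrassCurve ℚ) [V.IsElliptic] [V.IsGloballyMinimal]
    (hVW : ∃ C : VariableChange ℚ, C • V.quadraticTwist (-(p : ℚ)) = W) (hord : GoodOrd V p)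
    (hr : W.analyticRank = 1) {Dh : PAdicHeightData W p} (hTw : TwistedBranchGrossZagierAt W p Dh) :
    TameBranchPAdicGrossZagierAt W p Dh := by
  intro N _ f ε α B hf _hε hα hB ϖ hϖ
  have hp2 : p ≠ 2 := by omega
  have hmw : W.mordellWeilRank = 1 := by rw [(hGZK W (by rw [hr])).1, hr]
  have hordI : IsOrdinaryAt V p := hord
  haveI : NeZero (V.conductorNorm ℤ) := ⟨(V.conductorNorm_pos_holds).ne'⟩
  obtain ⟨Dm⟩ := hmodD V
  obtain ⟨ϖ', -, hϖ'⟩ := exists_rat_mul_imaginaryPeriodRat_eq_minusPeriod Dm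
  obtain ⟨C, hC⟩ := hVW
  obtain ⟨c, hrel, hc⟩ := exists_legendreTwistMinusRel_eq_periodIndex hp4 V W ⟨C, hC⟩ hadd
    (Or.inl hord.1) hf Dm.isNewformOf ϖ ϖ' hϖ hϖ'
  have hnamed := isTameBranchOf_legendre_C_mul_padicLFunctionMinusBranch V hp2 hordI Dm.isNewformOf hrel
  -- the V-clause (odd rows)
  obtain ⟨q, hlead, -, hoddc⟩ := hTw hr V Dm.f (Or.inl hord.1) Dm.isNewformOf
  obtain ⟨u, hu⟩ := (hoddc C ϖ' hp4 hC hϖ').1 hordI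
  rw [hmw, pow_one]
  -- the unit `n⁻¹`
  set n : ℕ := (W.baseChange ℝ).numRealComponents with hn
  have hndvd : ¬ p ∣ n := by
    have h5 : 3 ≤ p := by have := hp.out.two_le; omega
    rcases numRealComponents_eq_one_or_two (W.baseChange ℝ) with h1 | h2
    · rw [hn, h1]; intro hd; exact absurd (Nat.le_of_dvd one_pos hd) (by omega)
    · rw [hn, h2]; intro hd; exact absurd (Nat.le_of_dvd two_pos hd) (by omega)
  obtain ⟨v, hv⟩ := GaloisImage.GroupRingEval.exists_units_coe_eq_natCast (p := p) hndvd
  have hnQ : (n : ℚ_[p]) ≠ 0 := by rw [← hv]; exact coe_units_ne_zero p v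
  have hvinv : (((v⁻¹ : ℤ_[p]ˣ) : ℤ_[p]) : ℚ_[p]) = (n : ℚ_[p])⁻¹ := by
    have h2 : ((v⁻¹ : ℤ_[p]ˣ) : ℤ_[p]) * (v : ℤ_[p]) = 1 := v.inv_mul
    have h3 := congrArg ((↑) : ℤ_[p] → ℚ_[p]) h2
    rw [PadicInt.coe_mul, hv, PadicInt.coe_one] at h3
    exact eq_inv_of_mul_eq_one_left h3
  have hϖ0 : ϖ ≠ 0 := X2.varpi_ne_zero_of_isNewformOf hf hϖ
  have hϖ'0 : ϖ' ≠ 0 := by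
    intro h0
    rw [h0, Rat.cast_zero, zero_mul] at hϖ'
    exact (IsNewform0.minusPeriod_pos_holds Dm.isNewformOf.1 Dm.isNewformOf.coeffField_eq_bot).ne' hϖ'.symm
  have hϖQ : ((ϖ : ℚ) : ℚ_[p]) ≠ 0 := by exact_mod_cast hϖ0
  have hn0Q : (n : ℚ) ≠ 0 := by exact_mod_cast (W.baseChange ℝ).numRealComponents_pos.ne'
  have hc0 : (c : ℚ_[p]) ≠ 0 := by
    have : c ≠ 0 := by
      rcases hc with hc | hc <;> rw [hc]
      · exact div_ne_zero hϖ'0 (mul_ne_zero hn0Q hϖ0)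
      · exact neg_ne_zero.mpr (div_ne_zero hϖ'0 (mul_ne_zero hn0Q hϖ0))
    exact_mod_cast this
  set L := padicLFunctionMinusBranch Dm.f (unitRoot V p : ℚ_[p]) (p / 2) with hL
  by_cases hBn : PowerSeries.C (c : ℚ_[p]) * L = 0
  · have hL0 : L = 0 := by
      rcases mul_eq_zero.mp hBn with h | h
      · exact absurd (by simpa using congrArg (PowerSeries.constantCoeff) h) hc0
      · exact h
    have hB0 : B = 0 := by
      by_contra hB0
      rcases hB.eq_zero_or_tuple_eq hp2 hnamed hB0 with ⟨hα0, -⟩ | ⟨-, -, hBB⟩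
      · exact (unitRoot_coe_spec (W := V) (p := p) hordI).2.2 hα0
      · exact hB0 (hBB ▸ hBn)
    have hqR : (q : ℚ_[p]) * padicRegulator Dh = 0 := by
      have h0 : (ϖ' : ℚ_[p]) * PowerSeries.coeff 1 L * padicLog p (cyclotomicGenerator p) = 0 := by
        rw [hL0, map_zero, mul_zero, zero_mul]
      rw [hu, mul_assoc] at h0
      rcases mul_eq_zero.mp h0 with h | h
      · exact absurd h (coe_units_ne_zero p u)
      · exact h
    refine ⟨u, q, hlead, ?_⟩
    rw [hB0, map_zero, mul_zero, zero_mul, mul_assoc, hqR, mul_zero]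
  · rcases hnamed.eq_zero_or_tuple_eq hp2 hB hBn with ⟨hα0, -⟩ | ⟨-, -, hBB⟩
    · exact absurd (by rw [hα0, norm_zero] : ‖α‖ = 0) (by rw [hα]; exact one_ne_zero)
    · rcases hc with hc | hc
      · refine ⟨u * v⁻¹, q, hlead, ?_⟩
        rw [hBB, PowerSeries.coeff_C_mul, hc, Units.val_mul, PadicInt.coe_mul, hvinv]
        push_cast
        rw [show ((ϖ : ℚ) : ℚ_[p]) * ((ϖ' : ℚ_[p]) / ((n : ℚ_[p]) * (ϖ : ℚ_[p])) * PowerSeries.coeff 1 L) *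
            padicLog p (cyclotomicGenerator p) =
            (n : ℚ_[p])⁻¹ * ((ϖ' : ℚ_[p]) * PowerSeries.coeff 1 L * padicLog p (cyclotomicGenerator p)) by
          field_simp, hu]
        ring
      · refine ⟨-(u * v⁻¹), q, hlead, ?_⟩
        rw [hBB, PowerSeries.coeff_C_mul, hc, Units.val_neg, PadicInt.coe_neg, Units.val_mul,
          PadicInt.coe_mul, hvinv]
        push_cast
        rw [show ((ϖ : ℚ) : ℚ_[p]) * (-((ϖ' : ℚ_[p]) / ((n : ℚ_[p]) * (ϖ : ℚ_[p]))) * PowerSeries.coeff 1 L) *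
            padicLog p (cyclotomicGenerator p) =
            -(n : ℚ_[p])⁻¹ * ((ϖ' : ℚ_[p]) * PowerSeries.coeff 1 L * padicLog p (cyclotomicGenerator p)) by
          field_simp, hu]
        ring

/-! ### §3 The E-currency datum from the defect-2 fact, and the L3.N1″ HEADLINE supplied (odd rows) -/

/-- **The defect-2 fact in E-currency, (G-ord, `e = 2`), `p ≡ 3 (mod 4)`, `p ≥ 5`** (so `p ≥ 7`): one
datum `Dh` with Delbourgo's (B)-clauses AND `TameBranchPAdicGrossZagierAt W p Dh`, from the displayed
fact `hFact`. [cite: Delbourgo2002, Theorem (B) (p. 40)] [cite: Pal2012, Thm. 3.2 (case d < 0)]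
[cite: Disegni2017, Thm. B (§1.3.2) (provenance of `hFact`; nothing asserted)] -/
theorem exists_leadingTermClauses_and_tameBranchPAdicGrossZagierAt_of_delbourgoDatumFact_odd
    (hFact : delbourgoDatum_rankOne_leadingTerms) (hmodD : nonempty_modularParametrizationData)
    (hGZK : rank_eq_analyticRank_of_analyticRank_le_one) (hp4 : p % 4 = 3) (hp5 : 5 ≤ p)
    (hcm : ¬ W.HasCM) (hadd : Addv W p) (hG : TypeGOrd W p) (he : semistabilityIndex W p = 2)
    (hr : W.analyticRank = 1) :
    ∃ Dh : PAdicHeightData W p, LeadingTermClauses W p Dh ∧ TameBranchPAdicGrossZagierAt W p Dh := by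
  have hp2 : p ≠ 2 := by omega
  obtain ⟨Dh, hB, hTw⟩ := hFact W p hp2 hcm hadd hr (Or.inl ⟨hp5, hG⟩)
  obtain ⟨V, iV, iVm, C, hV, hC⟩ := TypeGOrd.exists_goodOrd_pStar_twist_model W p hp2 hG hadd he
  have hps : ((-1 : ℚ) ^ (p / 2) * (p : ℚ)) = -(p : ℚ) := by
    rw [pStar_eq_of_mod_four p (Or.inr hp4), if_neg (by omega)]
  exact ⟨Dh, hB, tameBranchPAdicGrossZagierAt_of_twisted_of_goodOrd_twist_odd hp4 hmodD hGZK hadd V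
    ⟨C, by rw [← hps]; exact hC⟩ hV hr hTw⟩

/-- **L3.N1″ HEADLINE SUPPLIED at defect 2, `p ≡ 3 (mod 4)`, `p ≥ 7`: the LOWER half
`Typed.MissingLowerBoundAt W p` on (G-ord, `e = 2`) rank-one rows from PRINT + the defect-2 fact + ONE
certified E-normalised tame branch** (odd twin of
`missingLowerBoundAt_rankOne_two_of_delbourgoDatumFact_of_thmC_of_cert`). Nothing booked.
[cite: Delbourgo2002, Theorem (A), (B), (C) (p. 40)] [cite: Miller2011LMS, Def. 1.1] -/
theorem missingLowerBoundAt_rankOne_two_odd_of_delbourgoDatumFact_of_thmC_of_cert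
    (hFact : delbourgoDatum_rankOne_leadingTerms)
    (hC : Delbourgo2002.thmC_charIdeal_dvd_tameBranch) (hDel : Delbourgo2002.mainTheorem)
    (hDelM : Delbourgo2002.mainTheorem_potMult) (hmodD : nonempty_modularParametrizationData)
    (hGZK : rank_eq_analyticRank_of_analyticRank_le_one)
    (hp4 : p % 4 = 3) (hp5 : 5 ≤ p) (hcm : ¬ W.HasCM) (hadd : Addv W p) (hG : TypeGOrd W p)
    (he : semistabilityIndex W p = 2) (hr : W.analyticRank = 1) (hna : ReductionNonAnomalous W p)
    {N : ℕ} [NeZero N] {f : CuspForm (Gamma0 N) 2} {ε : DirichletCharacter ℂ_[p] p} {α : ℚ_[p]}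
    {B : PowerSeries ℚ_[p]}
    (hf : IsNewformOf W f) (hε : orderOf ε = tameDefect W p) (hα : ‖α‖ = 1)
    (hB : IsTameBranchOf f p ε α B) (hint : ∀ j : ℕ, ‖PowerSeries.coeff j B‖ ≤ 1)
    (hunit : ‖PowerSeries.coeff 1 B‖ = 1)
    (ϖ : ℚ) (hϖ : (ϖ : ℝ) * W.realPeriodRat = plusPeriod f) (hϖv : padicValRat p ϖ ≤ 0)
    {s : ℚ} (hs : shaAn W = (s : ℂ)) :
    MissingLowerBoundAt W p := by
  have hp2 : p ≠ 2 := by omega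
  obtain ⟨Dh, hBcl, hGZ⟩ :=
    exists_leadingTermClauses_and_tameBranchPAdicGrossZagierAt_of_delbourgoDatumFact_odd hFact hmodD hGZK
      hp4 hp5 hcm hadd hG he hr
  exact missingLowerBoundAt_rankOne_of_tameBranchRatDvdAt_of_tameBranchPAdicGrossZagier
    (tameBranchRatDvdAt_of_thmC hC hDel hDelM hp5 hcm) hp2 hadd (Or.inr hG) hf hε hα hB hint hunit ϖ hϖ
    hϖv hBcl hGZ (fun κ γ hκ hγ D ↦ hDel.isTorsion hp5 hcm hadd hG hκ hγ D) hGZK hr hna hs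

end Summit.BirchSwinnertonDyer.Rank1Residual.Additive

end
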